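import Summits.Ventures.YMGap.Thresholds.OneLinkLevelTwoBootTilde
import HarnessLib

/-!
# Venture YMGap — the one-link modulus beyond first order, part 53: rational ENVELOPES of the `ω̃` ingredients — `ω̃(N,R)` and the
# nested constant `K₂QT(N,R)` — for the rows of the `ω̃` bootstrap modulus `K₂BT`

HONEST FRAMING: venture file of the cell `pub-ymgap` (QuantumFields programme), strong-coupling LATTICE bookkeeping for `SU(N)`
lattice Yang–Mills; pure real arithmetic, no measure, no number of record.  The rows of `K₂BT` (next files) feed
`oneLinkKRModulus_levelTwoBT_of_le` with RATIONAL majorants of its seven ingredients at `N ≥ N₀`, `R ≤ R₀`; five of them are in the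
tree (`casimirFactor_le`, `levelTwoE_le`, `sqrt_omegaPlus_le`, `tau_le`, and `R ≤ R₀` itself); this file supplies the remaining two:
* `levelTwoQShape_mono'`: monotonicity of the `K₂Q`-shape in all six ingredients `C, A, E, R, w, τ` (the tree's `levelTwoQShape_mono`
  keeps `C, E` fixed);
* `omegaTilde_le`: `ω̃(N,R) ≤ (τ̄ + R₀²)/4 + u` for rationals `q ≥ √(R₀²/4 + 1/N₀²)`, `t ≥ √(b̄²/4 + c̄)` (as in `tau_le`, `τ̄ = R₀(b̄/2 + t)`)
  and `u ≥ √((τ̄ + R₀²)²/16 + R₀²/N₀²)`;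
* `levelTwoQTK_le`: `K₂QT(N,R) ≤ K̄₂QT(N₀,R₀; q,p,t,u) = C(N₀)(p + E(N₀)R₀ + 2(E(N₀)+¼)ω̃̄ + (3E(N₀)R₀² + (2E(N₀)+¼)τ̄ + (10E(N₀)+½)R₀ω̃̄)/(½−R₀))`
  (`p ≥ √((1+ω̄⁺)/2)` as in `sqrt_omegaPlus_le`).
Cell note `HOME/p2/ONE-LINK-HIERARCHY.md` §15 (2′); pickers `work/hier/rows_pick_bt.py`.
-/

noncomputable section

open scoped Matrix ComplexConjugate BigOperators ContDiff Matrix.Norms.Frobenius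
open Matrix Complex Finset MeasureTheory ProbabilityTheory
open Literature.MathematicalPhysics.QuantumFieldTheory
open Literature.MathematicalPhysics.QuantumFieldTheory.SUNBakryEmery
open Literature.MathematicalPhysics.QuantumFieldTheory.Balaban1983to89.StrongCouplingDobrushinWindow
open Literature.MathematicalPhysics.QuantumFieldTheory.Balaban1983to89.StrongCouplingKernelWindow

namespace Summit.Ventures.YMGap.OneLinkEigen

variable {N : ℕ}

section LevelTwoBTEnvelope

open Summit.Ventures.YMGap.OneLinkEigenRows (casimirFactor_le)

/-- Monotonicity of the `K₂Q`/`K₂QT` SHAPE in all six ingredients `C, A, E, R, w, τ` (pure real arithmetic). [folklore] -/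
theorem levelTwoQShape_mono' {C C' A A' E E' R R' w w' τ τ' : ℝ}
    (hC : C ≤ C') (hA : A ≤ A') (hE : E ≤ E') (hR : R ≤ R') (hw : w ≤ w') (hτ : τ ≤ τ')
    (hC0 : 0 ≤ C) (hA0 : 0 ≤ A) (hE0 : 0 ≤ E) (hR0 : 0 ≤ R) (hw0 : 0 ≤ w) (hτ0 : 0 ≤ τ) (hR' : R' < 1 / 2) :
    C * (A + E * R + 2 * (E + 1 / 4) * w + (3 * E * R ^ 2 + (2 * E + 1 / 4) * τ + (10 * E + 1 / 2) * R * w) / (1 / 2 - R)) ≤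
      C' * (A' + E' * R' + 2 * (E' + 1 / 4) * w'
        + (3 * E' * R' ^ 2 + (2 * E' + 1 / 4) * τ' + (10 * E' + 1 / 2) * R' * w') / (1 / 2 - R')) := by
  have hT' : 0 < 1 / 2 - R' := by linarith only [hR']
  have hR'0 : 0 ≤ R' := hR0.trans hR
  have hE'0 : 0 ≤ E' := hE0.trans hE
  have hw'0 : 0 ≤ w' := hw0.trans hw
  have hτ'0 : 0 ≤ τ' := hτ0.trans hτ
  have p2 : R ^ 2 ≤ R' ^ 2 := pow_le_pow_left₀ hR0 hR 2
  have t1 : E * R ≤ E' * R' := mul_le_mul hE hR hR0 hE'0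
  have t2 : 2 * (E + 1 / 4) * w ≤ 2 * (E' + 1 / 4) * w' := mul_le_mul (by linarith only [hE]) hw hw0 (by positivity)
  have n1 : 3 * E * R ^ 2 ≤ 3 * E' * R' ^ 2 := mul_le_mul (by linarith only [hE]) p2 (by positivity) (by positivity)
  have n2 : (10 * E + 1 / 2) * R * w ≤ (10 * E' + 1 / 2) * R' * w' :=
    mul_le_mul (mul_le_mul (by linarith only [hE]) hR hR0 (by positivity)) hw hw0 (by positivity)
  have n3 : (2 * E + 1 / 4) * τ ≤ (2 * E' + 1 / 4) * τ' := mul_le_mul (by linarith only [hE]) hτ hτ0 (by positivity)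
  have hnum0 : 0 ≤ 3 * E * R ^ 2 + (2 * E + 1 / 4) * τ + (10 * E + 1 / 2) * R * w := by positivity
  have hfrac : (3 * E * R ^ 2 + (2 * E + 1 / 4) * τ + (10 * E + 1 / 2) * R * w) / (1 / 2 - R) ≤
      (3 * E' * R' ^ 2 + (2 * E' + 1 / 4) * τ' + (10 * E' + 1 / 2) * R' * w') / (1 / 2 - R') :=
    div_le_div₀ (hnum0.trans (by linarith only [n1, n2, n3])) (by linarith only [n1, n2, n3]) hT' (by linarith only [hR])
  have hT : 0 < 1 / 2 - R := by linarith only [hR', hR]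
  have hbody0 : 0 ≤ A + E * R + 2 * (E + 1 / 4) * w
      + (3 * E * R ^ 2 + (2 * E + 1 / 4) * τ + (10 * E + 1 / 2) * R * w) / (1 / 2 - R) := by positivity
  exact mul_le_mul hC (add_le_add (add_le_add (add_le_add hA t1) t2) hfrac) hbody0 (hC0.trans hC)

/-- **Envelope of `ω̃(N,R)`**: for `N ≥ N₀ ≥ 3`, `0 ≤ R ≤ R₀`, rationals `q ≥ √(R₀²/4 + 1/N₀²)`, `t ≥ √(b̄²/4 + c̄)`,
`u ≥ √((τ̄ + R₀²)²/16 + R₀²/N₀²)` (`τ̄ = R₀(b̄/2 + t)`): `ω̃(N,R) ≤ (τ̄ + R₀²)/4 + u`. [folklore] -/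
theorem omegaTilde_le {N₀ : ℕ} (hN₀ : 3 ≤ N₀) (hN : N₀ ≤ N) {R R₀ q t u : ℝ} (hR0 : 0 ≤ R) (hRR₀ : R ≤ R₀)
    (hq : 0 ≤ q) (hq2 : R₀ ^ 2 / 4 + 1 / (N₀ : ℝ) ^ 2 ≤ q ^ 2) (ht : 0 ≤ t)
    (ht2 : ((R₀) ^ 2 * (1 + (R₀) / 2 + (q)) / (2 - 4 / (N₀ : ℝ) ^ 2)) ^ 2 / 4 + ((R₀) ^ 2 * (4 / (N₀ : ℝ) ^ 2 + 2 * ((R₀) / 2 + (q)) ^ 2) / (2 - 4 / (N₀ : ℝ) ^ 2)) ≤ t ^ 2) (hu : 0 ≤ u)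
    (hu2 : (((R₀) * (((R₀) ^ 2 * (1 + (R₀) / 2 + (q)) / (2 - 4 / (N₀ : ℝ) ^ 2)) / 2 + (t))) + R₀ ^ 2) ^ 2 / 16 + R₀ ^ 2 / (N₀ : ℝ) ^ 2 ≤ u ^ 2) :
    (((R * ((R ^ 2 * (1 + R / 2 + Real.sqrt (R ^ 2 / 4 + 1 / (N : ℝ) ^ 2)) / (2 - 4 / (N : ℝ) ^ 2)) / 2 + Real.sqrt ((R ^ 2 * (1 + R / 2 + Real.sqrt (R ^ 2 / 4 + 1 / (N : ℝ) ^ 2)) / (2 - 4 / (N : ℝ) ^ 2)) ^ 2 / 4 + (R ^ 2 * (4 / (N : ℝ) ^ 2 + 2 * (R / 2 + Real.sqrt (R ^ 2 / 4 + 1 / (N : ℝ) ^ 2)) ^ 2) / (2 - 4 / (N : ℝ) ^ 2))))) + R ^ 2) / 4 + Real.sqrt (((R * ((R ^ 2 * (1 + R / 2 + Real.sqrt (R ^ 2 / 4 + 1 / (N : ℝ) ^ 2)) / (2 - 4 / (N : ℝ) ^ 2)) / 2 + Real.sqrt ((R ^ 2 * (1 + R / 2 + Real.sqrt (R ^ 2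 / 4 + 1 / (N : ℝ) ^ 2)) / (2 - 4 / (N : ℝ) ^ 2)) ^ 2 / 4 + (R ^ 2 * (4 / (N : ℝ) ^ 2 + 2 * (R / 2 + Real.sqrt (R ^ 2 / 4 + 1 / (N : ℝ) ^ 2)) ^ 2) / (2 - 4 / (N : ℝ) ^ 2))))) + R ^ 2) ^ 2 / 16 + R ^ 2 / (N : ℝ) ^ 2)) ≤ ((((R₀) * (((R₀) ^ 2 * (1 + (R₀) / 2 + (q)) / (2 - 4 / (N₀ : ℝ) ^ 2)) / 2 + (t))) + (R₀) ^ 2) / 4 + (u)) := by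
  have h0 : (3 : ℝ) ≤ N₀ := by exact_mod_cast hN₀
  have h1 : (N₀ : ℝ) ≤ N := by exact_mod_cast hN
  have hN₀pos : (0 : ℝ) < N₀ := by linarith
  have hN3 : 3 ≤ N := le_trans hN₀ hN
  have htau := tau_le hN₀ hN hR0 hRR₀ hq hq2 ht ht2
  have htau0 := tau_nonneg hN3 hR0
  have p2 : R ^ 2 ≤ R₀ ^ 2 := pow_le_pow_left₀ hR0 hRR₀ 2
  have hs : (R * ((R ^ 2 * (1 + R / 2 + Real.sqrt (R ^ 2 / 4 + 1 / (N : ℝ) ^ 2)) / (2 - 4 / (N : ℝ) ^ 2)) / 2 + Real.sqrt ((R ^ 2 * (1 + R / 2 + Real.sqrt (R ^ 2 / 4 + 1 / (N : ℝ) ^ 2)) / (2 - 4 / (N : ℝ) ^ 2)) ^ 2 / 4 + (R ^ 2 * (4 / (N : ℝ) ^ 2 + 2 * (R / 2 + Real.sqrt (R ^ 2 / 4 + 1 / (N : ℝ) ^ 2)) ^ 2) / (2 - 4 / (N : ℝ) ^ 2))))) + R ^ 2 ≤ ((R₀) * (((R₀) ^ 2 * (1 + (R₀) / 2 + (q)) /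 (2 - 4 / (N₀ : ℝ) ^ 2)) / 2 + (t))) + R₀ ^ 2 := add_le_add htau p2
  have hs0 : 0 ≤ (R * ((R ^ 2 * (1 + R / 2 + Real.sqrt (R ^ 2 / 4 + 1 / (N : ℝ) ^ 2)) / (2 - 4 / (N : ℝ) ^ 2)) / 2 + Real.sqrt ((R ^ 2 * (1 + R / 2 + Real.sqrt (R ^ 2 / 4 + 1 / (N : ℝ) ^ 2)) / (2 - 4 / (N : ℝ) ^ 2)) ^ 2 / 4 + (R ^ 2 * (4 / (N : ℝ) ^ 2 + 2 * (R / 2 + Real.sqrt (R ^ 2 / 4 + 1 / (N : ℝ) ^ 2)) ^ 2) / (2 - 4 / (N : ℝ) ^ 2))))) + R ^ 2 := by positivity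
  have hsq : ((R * ((R ^ 2 * (1 + R / 2 + Real.sqrt (R ^ 2 / 4 + 1 / (N : ℝ) ^ 2)) / (2 - 4 / (N : ℝ) ^ 2)) / 2 + Real.sqrt ((R ^ 2 * (1 + R / 2 + Real.sqrt (R ^ 2 / 4 + 1 / (N : ℝ) ^ 2)) / (2 - 4 / (N : ℝ) ^ 2)) ^ 2 / 4 + (R ^ 2 * (4 / (N : ℝ) ^ 2 + 2 * (R / 2 + Real.sqrt (R ^ 2 / 4 + 1 / (N : ℝ) ^ 2)) ^ 2) / (2 - 4 / (N : ℝ) ^ 2))))) + R ^ 2) ^ 2 ≤ (((R₀) * (((R₀) ^ 2 * (1 + (R₀) / 2 + (q)) / (2 - 4 / (N₀ : ℝ) ^ 2)) / 2 + (t))) + R₀ ^ 2) ^ 2 := pow_le_pow_left₀ hs0 hs 2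
  have hN2 : R ^ 2 / (N : ℝ) ^ 2 ≤ R₀ ^ 2 / (N₀ : ℝ) ^ 2 :=
    div_le_div₀ (by positivity) p2 (by positivity) (pow_le_pow_left₀ hN₀pos.le h1 2)
  have hroot : Real.sqrt (((R * ((R ^ 2 * (1 + R / 2 + Real.sqrt (R ^ 2 / 4 + 1 / (N : ℝ) ^ 2)) / (2 - 4 / (N : ℝ) ^ 2)) / 2 + Real.sqrt ((R ^ 2 * (1 + R / 2 + Real.sqrt (R ^ 2 / 4 + 1 / (N : ℝ) ^ 2)) / (2 - 4 / (N : ℝ) ^ 2)) ^ 2 / 4 + (R ^ 2 * (4 / (N : ℝ) ^ 2 + 2 * (R / 2 + Real.sqrt (R ^ 2 / 4 + 1 / (N : ℝ) ^ 2)) ^ 2) / (2 - 4 / (N : ℝ) ^ 2))))) + R ^ 2) ^ 2 / 16 + R ^ 2 / (N : ℝ) ^ 2) ≤ u :=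
    (Real.sqrt_le_sqrt (by linarith only [hsq, hN2, hu2])).trans (le_of_eq (Real.sqrt_sq hu))
  linarith only [hs, hroot]

set_option maxHeartbeats 400000 in
/-- **Numerical envelope of the nested constant `K₂QT(N,R)`**: for `N ≥ N₀ ≥ 3`, `0 ≤ R ≤ R₀ < 1/2` and rationals `q, p, t, u ≥ 0` as in
`sqrt_omegaPlus_le`, `tau_le`, `omegaTilde_le`: `K₂QT(N,R) ≤ K̄₂QT(N₀,R₀; q,p,t,u)` (an instance of `levelTwoQShape_mono'`; double
heartbeats for the elaboration of the ≈ 4 kB statement). [folklore] -/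
theorem levelTwoQTK_le {N₀ : ℕ} (hN₀ : 3 ≤ N₀) (hN : N₀ ≤ N) {R R₀ q p t u : ℝ} (hR0 : 0 ≤ R) (hRR₀ : R ≤ R₀) (hR₀ : R₀ < 1 / 2)
    (hq : 0 ≤ q) (hq2 : R₀ ^ 2 / 4 + 1 / (N₀ : ℝ) ^ 2 ≤ q ^ 2) (hp : 0 ≤ p)
    (hp2 : (1 + ((2 * ((2 * (N₀ : ℝ) ^ 2 - 4) / (4 * (N₀ : ℝ) ^ 2 - 20)) * ((R₀) + ((R₀) ^ 2 / 2 + (R₀) * (q))) + 2 * (2 * (N₀ : ℝ) ^ 2 / (4 * (N₀ : ℝ) ^ 2 - 20)) * (((R₀) ^ 2 / 2 + (R₀) * (q)) + (R₀) * ((R₀) / 2 + (q)) ^ 2)))) / 2 ≤ p ^ 2) (ht : 0 ≤ t)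
    (ht2 : ((R₀) ^ 2 * (1 + (R₀) / 2 + (q)) / (2 - 4 / (N₀ : ℝ) ^ 2)) ^ 2 / 4 + ((R₀) ^ 2 * (4 / (N₀ : ℝ) ^ 2 + 2 * ((R₀) / 2 + (q)) ^ 2) / (2 - 4 / (N₀ : ℝ) ^ 2)) ≤ t ^ 2) (hu : 0 ≤ u)
    (hu2 : (((R₀) * (((R₀) ^ 2 * (1 + (R₀) / 2 + (q)) / (2 - 4 / (N₀ : ℝ) ^ 2)) / 2 + (t))) + R₀ ^ 2) ^ 2 / 16 + R₀ ^ 2 / (N₀ : ℝ) ^ 2 ≤ u ^ 2) :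
    ((N : ℝ) ^ 2 / ((N : ℝ) ^ 2 - 1)) *
        (Real.sqrt ((1 +
            (2 * ((N : ℝ) * (2 * (N : ℝ) - 4 / N) / ((2 * (N : ℝ) - 4 / N) ^ 2 - 4)) *
            (R + (R ^ 2 / 2 + R * Real.sqrt (R ^ 2 / 4 + 1 / (N : ℝ) ^ 2)))
          + 2 * (2 * (N : ℝ) / ((2 * (N : ℝ) - 4 / N) ^ 2 - 4)) * N *
            ((R ^ 2 / 2 + R * Real.sqrt (R ^ 2 / 4 + 1 / (N : ℝ) ^ 2))
              + R * (R / 2 + Real.sqrt (R ^ 2 / 4 + 1 / (N : ℝ) ^ 2)) ^ 2))) / 2)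
          + ((N : ℝ) ^ 2 / (2 * ((N : ℝ) ^ 2 - 4))) * R + 2 * (((N : ℝ) ^ 2 / (2 * ((N : ℝ) ^ 2 - 4))) + 1 / 4) * (((R * ((R ^ 2 * (1 + R / 2 + Real.sqrt (R ^ 2 / 4 + 1 / (N : ℝ) ^ 2)) / (2 - 4 / (N : ℝ) ^ 2)) / 2 + Real.sqrt ((R ^ 2 * (1 + R / 2 + Real.sqrt (R ^ 2 / 4 + 1 / (N : ℝ) ^ 2)) / (2 - 4 / (N : ℝ) ^ 2)) ^ 2 / 4 + (R ^ 2 * (4 / (N : ℝ) ^ 2 + 2 * (R / 2 + Real.sqrt (R ^ 2 / 4 + 1 / (N : ℝ) ^ 2)) ^ 2) / (2 - 4 / (N : ℝ) ^ 2))))) + R ^ 2) / 4 + Real.sqrt (((R * ((R ^ 2 * (1 + R / 2 + Real.sqrt (R ^ 2 / 4 + 1 / (N : ℝ) ^ 2)) / (2 - 4 / (N : ℝ) ^ 2)) / 2 + Real.sqrt ((R ^ 2 * (1 + R / 2 + Real.sqrt (R ^ 2 / 4 + 1 / (N : ℝ) ^ 2)) / (2 - 4 / (N : ℝ) ^ 2))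 ^ 2 / 4 + (R ^ 2 * (4 / (N : ℝ) ^ 2 + 2 * (R / 2 + Real.sqrt (R ^ 2 / 4 + 1 / (N : ℝ) ^ 2)) ^ 2) / (2 - 4 / (N : ℝ) ^ 2))))) + R ^ 2) ^ 2 / 16 + R ^ 2 / (N : ℝ) ^ 2))
          + (3 * ((N : ℝ) ^ 2 / (2 * ((N : ℝ) ^ 2 - 4))) * R ^ 2 + (2 * ((N : ℝ) ^ 2 / (2 * ((N : ℝ) ^ 2 - 4))) + 1 / 4) * (R * ((R ^ 2 * (1 + R / 2 + Real.sqrt (R ^ 2 / 4 + 1 / (N : ℝ) ^ 2)) / (2 - 4 / (N : ℝ) ^ 2)) / 2 + Real.sqrt ((R ^ 2 * (1 + R / 2 + Real.sqrt (R ^ 2 / 4 + 1 / (N : ℝ) ^ 2)) / (2 - 4 / (N : ℝ) ^ 2)) ^ 2 / 4 + (R ^ 2 * (4 / (N : ℝ) ^ 2 + 2 * (R / 2 + Real.sqrt (R ^ 2 / 4 + 1 / (N : ℝ) ^ 2)) ^ 2) / (2 - 4 / (N : ℝ) ^ 2)))))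
              + (10 * ((N : ℝ) ^ 2 / (2 * ((N : ℝ) ^ 2 - 4))) + 1 / 2) * R * (((R * ((R ^ 2 * (1 + R / 2 + Real.sqrt (R ^ 2 / 4 + 1 / (N : ℝ) ^ 2)) / (2 - 4 / (N : ℝ) ^ 2)) / 2 + Real.sqrt ((R ^ 2 * (1 + R / 2 + Real.sqrt (R ^ 2 / 4 + 1 / (N : ℝ) ^ 2)) / (2 - 4 / (N : ℝ) ^ 2)) ^ 2 / 4 + (R ^ 2 * (4 / (N : ℝ) ^ 2 + 2 * (R / 2 + Real.sqrt (R ^ 2 / 4 + 1 / (N : ℝ) ^ 2)) ^ 2) / (2 - 4 / (N : ℝ) ^ 2))))) + R ^ 2) / 4 + Real.sqrt (((R * ((R ^ 2 * (1 + R / 2 + Real.sqrt (R ^ 2 / 4 + 1 / (N : ℝ) ^ 2)) / (2 - 4 / (N : ℝ) ^ 2)) / 2 + Real.sqrt ((R ^ 2 * (1 + R / 2 + Real.sqrt (R ^ 2 / 4 + 1 / (N : ℝ) ^ 2)) / (2 - 4 / (N : ℝ) ^ 2)) ^ 2 / 4 + (R ^ 2 * (4 / (N : ℝ) ^ 2 +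 2 * (R / 2 + Real.sqrt (R ^ 2 / 4 + 1 / (N : ℝ) ^ 2)) ^ 2) / (2 - 4 / (N : ℝ) ^ 2))))) + R ^ 2) ^ 2 / 16 + R ^ 2 / (N : ℝ) ^ 2))) / (1 / 2 - R)) ≤
      ((N₀ : ℝ) ^ 2 / ((N₀ : ℝ) ^ 2 - 1)) *
        ((p) + ((N₀ : ℝ) ^ 2 / (2 * ((N₀ : ℝ) ^ 2 - 4))) * (R₀) + 2 * (((N₀ : ℝ) ^ 2 / (2 * ((N₀ : ℝ) ^ 2 - 4))) + 1 / 4) * ((((R₀) * (((R₀) ^ 2 * (1 + (R₀) / 2 + (q)) / (2 - 4 / (N₀ : ℝ) ^ 2)) / 2 + (t))) + (R₀) ^ 2) / 4 + (u))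
          + (3 * ((N₀ : ℝ) ^ 2 / (2 * ((N₀ : ℝ) ^ 2 - 4))) * (R₀) ^ 2 + (2 * ((N₀ : ℝ) ^ 2 / (2 * ((N₀ : ℝ) ^ 2 - 4))) + 1 / 4) * ((R₀) * (((R₀) ^ 2 * (1 + (R₀) / 2 + (q)) / (2 - 4 / (N₀ : ℝ) ^ 2)) / 2 + (t)))
              + (10 * ((N₀ : ℝ) ^ 2 / (2 * ((N₀ : ℝ) ^ 2 - 4))) + 1 / 2) * (R₀) * ((((R₀) * (((R₀) ^ 2 * (1 + (R₀) / 2 + (q)) / (2 - 4 / (N₀ : ℝ) ^ 2)) / 2 + (t))) + (R₀) ^ 2) / 4 + (u))) / (1 / 2 - (R₀))) := by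
  have h0 : (3 : ℝ) ≤ N₀ := by exact_mod_cast hN₀
  have h1 : (N₀ : ℝ) ≤ N := by exact_mod_cast hN
  have hN3 : 3 ≤ N := le_trans hN₀ hN
  have hC := casimirFactor_le (N₀ := N₀) (N := N) (by omega) hN
  have hE := levelTwoE_le hN₀ hN
  have hC0 : 0 ≤ (N : ℝ) ^ 2 / ((N : ℝ) ^ 2 - 1) := div_nonneg (by positivity) (by nlinarith only [h0, h1])
  have hE0 : 0 ≤ (N : ℝ) ^ 2 / (2 * ((N : ℝ) ^ 2 - 4)) := div_nonneg (by positivity) (by nlinarith only [h0, h1])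
  have b0 := sqrt_omegaPlus_le hN₀ hN hR0 hRR₀ hq hq2 hp hp2
  have hw := omegaTilde_le hN₀ hN hR0 hRR₀ hq hq2 ht ht2 hu hu2
  have htau := tau_le hN₀ hN hR0 hRR₀ hq hq2 ht ht2
  exact levelTwoQShape_mono' hC b0 hE hRR₀ hw htau hC0 (Real.sqrt_nonneg _) hE0 hR0 (omegaTilde_nonneg hN3 hR0)
    (tau_nonneg hN3 hR0) hR₀

end LevelTwoBTEnvelope

end Summit.Ventures.YMGap.OneLinkEigen
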